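import Summits.NavierStokesRegularity.NavierStokesRegularity.Theorems.ExtremiserTransienceScrewSymmetricNearAxisVanishing
import Summits.NavierStokesRegularity.NavierStokesRegularity.Theorems.ExtremiserTransienceBackwardConePropagation
import Summits.NavierStokesRegularity.NavierStokesRegularity.Theorems.SymmetryModuliCountSymmetricLiouvilleSmallAtMinusInfinity
import HarnessLib

/-!
# Rung R8 `ScrewSymmetricLiouville` of LINE g9-β `filament_selection` (crux stmt-NavierStokesRegularity-26567)

**Theorem** (`screwSymmetricLiouville`, the workfile Prop `ScrewSymmetricLiouville` of
`Cruxes/NearExtremalTransiencePerFlow/Lines/filament_selection.lean` VERBATIM): a Type-I ancient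
mild field `W ∈ A_K` (`IsTypeIAncientMild K W`, Oseen gauge) that is invariant at all negative times
under a screw motion `x ↦ L x + b` — `L` a linear isometry with `L b = b`, `b ≠ 0`,
`W τ (L x + b) = L (W τ x)` — vanishes identically. No hypothesis on the twist: rational
(finite-order `L`, the workfile's `screwSymmetricLiouville_finiteOrder`) and IRRATIONAL twists alike.

Proof, through the SYMMETRY-FREE theorem `eq_zero_of_small_nearOrigin`: an element of `A_C` whose
blow-downs centred at the origin all vanish (`√(−t)‖u(t,x)‖ ≤ ε` for `t < T(ε, D)`, `‖x‖ ≤ D√(−t)`)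
is identically zero. (D) By the Kato gap (`stub_smallAtMinusInfinityLiouville`: small at `−∞` ⇒
zero) it suffices to show `√(−t)‖u(t, x)‖ ≤ ε` for `t < T(ε)`, uniformly in `x`. If not, there are
violators `(t, x)` of a small level `ε' = min ε ε₁` with `t` below any threshold. (B) By the
symmetry-free BACKWARD-CONE PROPAGATION (`exists_backwardCone_violator`) a violator at `(t, x)`
produces violators at `(36^k t, x_k)` with `‖x_k − x‖ ≤ ρ√(−t)(6^k − 1)/5` — parabolic drift only,
no loss of level — so for `6^k√(−t) ≥ ‖x‖` the violator lies in the parabolic neighbourhood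
`‖x_k‖ ≤ (1 + ρ/5)√(−36^k t)` of the origin, where the hypothesis forbids violators at very negative
times. For R8 the hypothesis is (C) the NEAR-AXIS LEVER (`screwSymmetric_nearAxis_small`: KNSS
blow-down + syndetic returns of `L^k` + the `x₂`-independent Type-I-rate Liouville theorem).
[cite: KochNadirashviliSereginSverak2009, proof of Thm 6.2 (arXiv:0709.3599 p. 13)]
-/

noncomputable section

set_option linter.dupNamespace false

open Set Function Filter
open scoped Topology

namespace Summit.NavierStokesRegularity.NavierStokesRegularity.Theorems.ScrewSymmetricLiouville

open Literature.Analysis Literature.Analysis.FluidPDE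
open Summit.NavierStokesRegularity.NavierStokesRegularity.Theorems
open Summit.NavierStokesRegularity.NavierStokesRegularity.Theorems.SymmetryModuliCountSymmetricLiouville

/-- `√(−36^k t) = 6^k √(−t)` for `t ≤ 0`. [folklore] -/
theorem sqrt_neg_pow36_mul {t : ℝ} (ht : t ≤ 0) (k : ℕ) :
    Real.sqrt (-((36 : ℝ) ^ k * t)) = (6 : ℝ) ^ k * Real.sqrt (-t) := by
  rw [show -((36 : ℝ) ^ k * t) = ((6 : ℝ) ^ k) ^ 2 * -t by
      rw [← pow_mul, mul_comm k 2, pow_mul]; norm_num,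
    Real.sqrt_mul' _ (neg_nonneg.2 ht), Real.sqrt_sq (by positivity)]

/-- **(B) Iterated backward-cone propagation.** If violators of level `ε` at time `t₀` propagate to
time `36 t₀` within distance `ρ√(−t₀)` (the conclusion of `exists_backwardCone_violator` for the
field `u`), then a violator at `(t, x)` yields, for every `k`, a violator at time `36^k t` within
distance `ρ√(−t)(6^k − 1)/5` of `x`. [folklore] -/
theorem iterate_backwardCone {u : ℝ → EuclideanSpace ℝ (Fin 3) → EuclideanSpace ℝ (Fin 3)} {ε ρ : ℝ}
    (hprop : ∀ t₀ : ℝ, t₀ < 0 → ∀ x₀ : EuclideanSpace ℝ (Fin 3),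
      ε < Real.sqrt (-t₀) * ‖u t₀ x₀‖ →
      ∃ x' : EuclideanSpace ℝ (Fin 3), ‖x' - x₀‖ ≤ ρ * Real.sqrt (-t₀) ∧
        ε < Real.sqrt (-(36 * t₀)) * ‖u (36 * t₀) x'‖)
    {t : ℝ} (ht : t < 0) {x : EuclideanSpace ℝ (Fin 3)} (hviol : ε < Real.sqrt (-t) * ‖u t x‖) :
    ∀ k : ℕ, ∃ xk : EuclideanSpace ℝ (Fin 3),
      ‖xk - x‖ ≤ ρ * Real.sqrt (-t) * (((6 : ℝ) ^ k - 1) / 5) ∧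
        ε < Real.sqrt (-((36 : ℝ) ^ k * t)) * ‖u ((36 : ℝ) ^ k * t) xk‖ := by
  intro k
  induction k with
  | zero => exact ⟨x, by simp, by simpa using hviol⟩
  | succ k ih =>
    obtain ⟨xk, hxk, hvk⟩ := ih
    have htk : (36 : ℝ) ^ k * t < 0 := mul_neg_of_pos_of_neg (by positivity) ht
    obtain ⟨x', hx', hv'⟩ := hprop _ htk xk hvk
    refine ⟨x', ?_, ?_⟩
    · rw [sqrt_neg_pow36_mul ht.le] at hx'
      calc ‖x' - x‖ ≤ ‖x' - xk‖ + ‖xk - x‖ := norm_sub_le_norm_sub_add_norm_sub _ _ _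
        _ ≤ ρ * ((6 : ℝ) ^ k * Real.sqrt (-t)) + ρ * Real.sqrt (-t) * (((6 : ℝ) ^ k - 1) / 5) :=
            add_le_add hx' hxk
        _ = ρ * Real.sqrt (-t) * (((6 : ℝ) ^ (k + 1) - 1) / 5) := by rw [pow_succ]; ring
    · have e : 36 * ((36 : ℝ) ^ k * t) = (36 : ℝ) ^ (k + 1) * t := by rw [pow_succ]; ring
      rwa [e] at hv'

/-- **Blow-down vanishing at one point forces zero (symmetry-free).** If `u ∈ A_C` is
scale-invariantly small at `−∞` in every parabolic neighbourhood `‖x‖ ≤ D√(−t)` of the origin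
(equivalently: every blow-down sequence of `u` centred at the origin tends to `0`), then `u ≡ 0`:
a violator of uniform smallness anywhere is moved by the backward-cone propagation
(`exists_backwardCone_violator`, iterated) to very negative times with only parabolic spatial drift,
i.e. into the parabolic neighbourhood of the origin; uniform smallness at `−∞` then gives `u ≡ 0` by
the Kato gap `stub_smallAtMinusInfinityLiouville`. [cite: KochNadirashviliSereginSverak2009, §4 p. 8 (arXiv:0709.3599)] -/
theorem eq_zero_of_small_nearOrigin (C : ℝ) (u : ℝ → EuclideanSpace ℝ (Fin 3) → EuclideanSpace ℝ (Fin 3))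
    (hu : IsTypeIAncientMild C u)
    (hnear : ∀ ε > 0, ∀ D : ℝ, ∃ T < 0, ∀ t < T, ∀ x : EuclideanSpace ℝ (Fin 3),
      ‖x‖ ≤ D * Real.sqrt (-t) → Real.sqrt (-t) * ‖u t x‖ ≤ ε) :
    ∀ t : ℝ, t < 0 → ∀ x, u t x = 0 := by
  refine stub_smallAtMinusInfinityLiouville C u hu fun ε hε => ?_
  -- levels: `ε' = min ε ε₁`
  obtain ⟨ε₁, hε₁, hcone⟩ := exists_backwardCone_violator
  set ε' : ℝ := min ε ε₁ with hε'
  have hε'0 : 0 < ε' := lt_min hε hε₁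
  obtain ⟨ρ, hρ, hprop⟩ := hcone ε' hε'0 (min_le_right _ _) C
  -- smallness near the origin at level `ε'` in the parabolic neighbourhood of aperture `D = 1 + ρ/5`
  obtain ⟨T, hT, hsmallT⟩ := hnear ε' hε'0 (1 + ρ / 5)
  refine ⟨T, hT, fun t ht x => ?_⟩
  by_contra hcon
  push Not at hcon
  have ht0 : t < 0 := ht.trans hT
  have hviol : ε' < Real.sqrt (-t) * ‖u t x‖ := lt_of_le_of_lt (min_le_left _ _) hcon
  -- choose `k` with `‖x‖ ≤ 6^k √(-t)`
  have hst : 0 < Real.sqrt (-t) := Real.sqrt_pos.2 (neg_pos.2 ht0)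
  obtain ⟨k, hk⟩ : ∃ k : ℕ, ‖x‖ / Real.sqrt (-t) ≤ (6 : ℝ) ^ k := by
    obtain ⟨k, hk⟩ := pow_unbounded_of_one_lt (‖x‖ / Real.sqrt (-t)) (by norm_num : (1 : ℝ) < 6)
    exact ⟨k, hk.le⟩
  have hxk0 : ‖x‖ ≤ (6 : ℝ) ^ k * Real.sqrt (-t) := by rwa [div_le_iff₀ hst] at hk
  -- the propagated violator at time `36^k t`
  obtain ⟨xk, hxk, hvk⟩ := iterate_backwardCone (hprop u hu) ht0 hviol k
  have htk : (36 : ℝ) ^ k * t < T := by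
    have h1 : (1 : ℝ) ≤ (36 : ℝ) ^ k := one_le_pow₀ (by norm_num)
    nlinarith
  have hsq : Real.sqrt (-((36 : ℝ) ^ k * t)) = (6 : ℝ) ^ k * Real.sqrt (-t) := sqrt_neg_pow36_mul ht0.le k
  have hxk_near : ‖xk‖ ≤ (1 + ρ / 5) * Real.sqrt (-((36 : ℝ) ^ k * t)) := by
    rw [hsq]
    have h6 : (1 : ℝ) ≤ (6 : ℝ) ^ k := one_le_pow₀ (by norm_num)
    calc ‖xk‖ ≤ ‖xk - x‖ + ‖x‖ := by
          have := norm_add_le (xk - x) x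
          rwa [sub_add_cancel] at this
      _ ≤ ρ * Real.sqrt (-t) * (((6 : ℝ) ^ k - 1) / 5) + (6 : ℝ) ^ k * Real.sqrt (-t) := add_le_add hxk hxk0
      _ ≤ (1 + ρ / 5) * ((6 : ℝ) ^ k * Real.sqrt (-t)) := by nlinarith [hst.le, hρ.le]
  have hsmall := hsmallT _ htk xk hxk_near
  exact absurd hvk (not_lt.2 hsmall)

/-- **Rung R8 — `ScrewSymmetricLiouville`** (the workfile Prop VERBATIM): a Type-I ancient mild
field invariant at all negative times under a screw motion `x ↦ L x + b` (`L` a linear isometry,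
`L b = b`, `b ≠ 0`; ANY twist, rational or irrational) vanishes identically — the near-axis lever
`screwSymmetric_nearAxis_small` feeds `eq_zero_of_small_nearOrigin`. Module docstring for the
proof. [cite: KochNadirashviliSereginSverak2009, proof of Thm 6.2 (arXiv:0709.3599 p. 13)] -/
theorem screwSymmetricLiouville :
    ∀ (K : ℝ) (W : ℝ → EuclideanSpace ℝ (Fin 3) → EuclideanSpace ℝ (Fin 3))
      (L : EuclideanSpace ℝ (Fin 3) ≃ₗᵢ[ℝ] EuclideanSpace ℝ (Fin 3)) (b : EuclideanSpace ℝ (Fin 3)),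
      Literature.Analysis.FluidPDE.IsTypeIAncientMild K W → L b = b → b ≠ 0 →
      (∀ τ : ℝ, τ < 0 → ∀ x, W τ (L x + b) = L (W τ x)) → ∀ τ : ℝ, τ < 0 → ∀ x, W τ x = 0 :=
  fun K W L b hW hLb hb hsym =>
    eq_zero_of_small_nearOrigin K W hW (screwSymmetric_nearAxis_small K W L b hW hLb hb hsym)

end Summit.NavierStokesRegularity.NavierStokesRegularity.Theorems.ScrewSymmetricLiouville

end
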